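import Literature.NumberTheory.BeurlingPrimes.BDRTemplate
import HarnessLib

/-!
# The BDR template as a Stieltjes function, and the truncated density `f̃` with `|f̃| ≤ 2`

Topic `Literature/NumberTheory/BeurlingPrimes`, grouping namespace `BDR`. Everything in this file is PROVED.

Broucke–Debruyne–Révész (2023, proof of Theorem 3.2) apply the random prime approximation theorem (their
Theorem 1.2 = Broucke–Vindas 2024, Theorem 1.2; tree: `BrouckeVindas2024_thm12`, PROVED as
`BrouckeVindas2024_thm12_holds`) to the template `F = li + Σ_ω li(x^ω) − Σ_ρ li(x^ρ) + M li(x^δ)` of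
`BDRTemplate.lean`: "on noting that `F` is continuous, obviously satisfies `F(1) = 0`, and admits a bound
`F(x) ≪ x/log x`". This file packages `F` for that application (as `LiStieltjes.lean` does for `li`):

* `FStieltjes h : StieltjesFunction ℝ` (`F` monotone, continuous), `FStieltjes_measure` (`dF = f du`) and
  `stieltjesExpSum_FStieltjes` (`∫_{[1,x]} u^{−it} dF(u) = BV.tmplSum f x t`), and the hypotheses of Theorem 1.2;
* the **truncated density** `fT = f · 1_{(u₀, ∞)}`, `u₀ = e^{W/2}`: since `f ≤ W/log u`, `|fT| ≤ 2` on `(1, ∞)`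
  (`abs_fT_le_two`), `0 ≤ g − fT ≤ (W + W√u₀) u^{−1/2}` (`g_sub_fT_mem`), and the BV approximation hypothesis
  transfers, `BV.Approx f P A → BV.Approx fT P (A + W(u₀ − 1))` (`Approx.of_f`), because
  `‖S_f(x,t) − S_{fT}(x,t)‖ ≤ ∫₁^{u₀} f ≤ W(u₀ − 1) ≤ W(u₀ − 1)·gauge`. This is how the tree's Broucke–Vindas
  continuation files (`BVContinuation.lean`, written for densities bounded by `2`) are applied verbatim to the
  BDR template, whose density is bounded by `W = 1 + |S| + |R| + M` only.

## References
* [BrouckeDebruyneRevesz2023] F. Broucke, G. Debruyne, Sz. Gy. Révész, *Some examples of well-behaved Beurling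
  number systems*, arXiv:2309.01567, proof of Theorem 3.2 (application of Theorem 1.2 to `F`) (read, p. 8).
* [BrouckeVindas2024] F. Broucke, J. Vindas, Math. Z. 307 (2024), arXiv:2102.08478, Theorem 1.2.
-/

noncomputable section

open Complex Set Filter MeasureTheory intervalIntegral
open scoped Topology ENNReal NNReal

namespace Literature.NumberTheory.BeurlingPrimes

open Literature.Barriers.RiemannHypothesis

namespace BDR

variable {R S : Finset ℝ} {δ : ℝ} {M : ℕ}

/-! ### `F` as a Stieltjes function -/

/-- `F` as a Stieltjes function (monotone by Lemma 3.1, continuous). [cite: BrouckeDebruyneRevesz2023, proof of Theorem 3.2] -/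
def FStieltjes (h : Adm R S δ M) : StieltjesFunction ℝ where
  toFun := F R S δ M
  mono' := h.F_mono
  right_continuous' _ := h.continuous_F.continuousWithinAt

/-- `FStieltjes h x = F x`. [cite: BrouckeDebruyneRevesz2023, proof of Theorem 3.2] -/
@[simp] theorem FStieltjes_apply (h : Adm R S δ M) (x : ℝ) : FStieltjes h x = F R S δ M x := rfl

variable (h : Adm R S δ M)
include h

/-- `f` is integrable on every set of finite measure (`0 ≤ f ≤ W`). [folklore] -/
theorem Adm.integrableOn_f {s : Set ℝ} (hs : volume s < ∞) : IntegrableOn (f R S δ M) s := by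
  refine Measure.integrableOn_of_bounded (M := wBound R S M) hs.ne h.measurable_f.aestronglyMeasurable ?_
  exact Eventually.of_forall fun u ↦ by
    rw [Real.norm_eq_abs, abs_of_nonneg (h.f_nonneg u)]; exact h.f_le_wBound u

/-- `f` is interval integrable. [folklore] -/
theorem Adm.intervalIntegrable_f (a b : ℝ) : IntervalIntegrable (f R S δ M) volume a b :=
  intervalIntegrable_iff.mpr (h.integrableOn_f measure_Ioc_lt_top)

/-- **`∫ₐᵇ f = F b − F a`** for `a ≤ b`. [cite: BrouckeDebruyneRevesz2023, proof of Theorem 3.2] -/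
theorem Adm.integral_f_eq {a b : ℝ} (hab : a ≤ b) : ∫ u in a..b, f R S δ M u = F R S δ M b - F R S δ M a := by
  have hleft : ∀ {a b : ℝ}, a ≤ b → b ≤ 1 → ∫ u in a..b, f R S δ M u = F R S δ M b - F R S δ M a := by
    intro a b hab hb1
    rw [F_eq_zero_of_le_one hb1, F_eq_zero_of_le_one (hab.trans hb1), sub_zero]
    rw [intervalIntegral.integral_congr (g := fun _ ↦ (0 : ℝ)) fun u hu ↦ ?_]
    · simp
    · rw [uIcc_of_le hab] at hu
      exact f_of_le_one (hu.2.trans hb1)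
  have hright : ∀ {a b : ℝ}, a ≤ b → 1 ≤ a → ∫ u in a..b, f R S δ M u = F R S δ M b - F R S δ M a := by
    intro a b hab ha1
    exact intervalIntegral.integral_eq_sub_of_hasDerivAt_of_le hab h.continuous_F.continuousOn
      (fun u hu ↦ h.hasDerivAt_F (lt_of_le_of_lt ha1 hu.1)) (h.intervalIntegrable_f a b)
  rcases le_or_gt b 1 with hb1 | hb1
  · exact hleft hab hb1
  rcases le_or_gt 1 a with ha1 | ha1
  · exact hright hab ha1
  · have h1 : ∫ u in a..b, f R S δ M u = (∫ u in a..1, f R S δ M u) + ∫ u in (1:ℝ)..b, f R S δ M u :=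
      (intervalIntegral.integral_add_adjacent_intervals (h.intervalIntegrable_f a 1)
        (h.intervalIntegrable_f 1 b)).symm
    rw [h1, hleft ha1.le le_rfl, hright hb1.le le_rfl, F_one, F_eq_zero_of_le_one ha1.le]
    ring

/-- **`dF = f(u) du`**: the Lebesgue–Stieltjes measure of `F` has density `f`. [cite: BrouckeDebruyneRevesz2023, proof of Theorem 3.2] -/
theorem Adm.FStieltjes_measure :
    (FStieltjes h).measure = volume.withDensity (fun u ↦ ENNReal.ofReal (f R S δ M u)) := by
  refine Measure.ext_of_Ioc _ _ fun a b hab ↦ ?_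
  rw [StieltjesFunction.measure_Ioc, withDensity_apply _ measurableSet_Ioc, FStieltjes_apply, FStieltjes_apply,
    ← ofReal_integral_eq_lintegral_ofReal (h.integrableOn_f measure_Ioc_lt_top)
      (Eventually.of_forall fun u ↦ h.f_nonneg u),
    ← intervalIntegral.integral_of_le hab.le, h.integral_f_eq hab.le]

/-- **The template side of (1.3) for `F`**: `∫_{[1,x]} u^{−it} dF(u) = BV.tmplSum f x t` (`x ≥ 1`).
[cite: BrouckeDebruyneRevesz2023, proof of Theorem 3.2 (definition of `J(x,t)`)] -/
theorem Adm.stieltjesExpSum_FStieltjes {x : ℝ} (hx : 1 ≤ x) (t : ℝ) :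
    stieltjesExpSum (FStieltjes h) x t = BV.tmplSum (f R S δ M) x t := by
  rw [stieltjesExpSum, h.FStieltjes_measure]
  have hdens : (fun u ↦ ENNReal.ofReal (f R S δ M u)) = fun u ↦ ((Real.toNNReal (f R S δ M u) : ℝ≥0) : ℝ≥0∞) := rfl
  rw [hdens, setIntegral_withDensity_eq_setIntegral_smul h.measurable_f.real_toNNReal _ measurableSet_Icc,
    integral_Icc_eq_integral_Ioc, BV.tmplSum, intervalIntegral.integral_of_le hx]
  refine setIntegral_congr_fun measurableSet_Ioc fun u _ ↦ ?_
  rw [BV.tmplIntegrand, NNReal.smul_def, Real.coe_toNNReal _ (h.f_nonneg u), Complex.real_smul]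

/-- The Chebyshev hypothesis of Theorem 1.2 for `F`. [cite: BrouckeDebruyneRevesz2023, proof of Theorem 3.2] -/
theorem Adm.FStieltjes_chebyshev : ∃ C : ℝ, ∀ x : ℝ, 2 ≤ x → FStieltjes h x ≤ C * x / Real.log x :=
  ⟨2 * wBound R S M, fun x hx ↦ h.F_le_chebyshev (by linarith)⟩

/-! ### The truncated density -/

omit h in
/-- The truncation point `u₀ = e^{W/2}` (`f ≤ 2` beyond it). [cite: BrouckeDebruyneRevesz2023, proof of Theorem 3.2] -/
def cutoff (R S : Finset ℝ) (M : ℕ) : ℝ := Real.exp (wBound R S M / 2)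

omit h in
/-- `1 < u₀`. [folklore] -/
theorem one_lt_cutoff : 1 < cutoff R S M := by
  unfold cutoff
  exact Real.one_lt_exp_iff.mpr (by have := wBound_pos (R := R) (S := S) (M := M); positivity)

omit h in
/-- **The truncated density** `fT = f · 1_{(u₀,∞)}`. [cite: BrouckeDebruyneRevesz2023, proof of Theorem 3.2] -/
def fT (R S : Finset ℝ) (δ : ℝ) (M : ℕ) (u : ℝ) : ℝ := if cutoff R S M < u then f R S δ M u else 0

omit h in
/-- `fT u = f u` beyond the cutoff. [folklore] -/
theorem fT_of_lt {u : ℝ} (hu : cutoff R S M < u) : fT R S δ M u = f R S δ M u := if_pos hu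

omit h in
/-- `fT u = 0` up to the cutoff. [folklore] -/
theorem fT_of_le {u : ℝ} (hu : u ≤ cutoff R S M) : fT R S δ M u = 0 := if_neg (not_lt.mpr hu)

/-- `fT` is measurable. [folklore] -/
theorem Adm.measurable_fT : Measurable (fT R S δ M) :=
  Measurable.ite measurableSet_Ioi h.measurable_f measurable_const

/-- `0 ≤ fT ≤ f`. [folklore] -/
theorem Adm.fT_mem (u : ℝ) : 0 ≤ fT R S δ M u ∧ fT R S δ M u ≤ f R S δ M u := by
  by_cases hu : cutoff R S M < u
  · rw [fT_of_lt hu]; exact ⟨h.f_nonneg u, le_rfl⟩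
  · rw [fT_of_le (not_lt.mp hu)]; exact ⟨le_rfl, h.f_nonneg u⟩

/-- **`|fT| ≤ 2` on `(1, ∞)`** (`f u ≤ W/log u ≤ 2` for `log u > W/2`). [cite: BrouckeDebruyneRevesz2023, proof of Theorem 3.2] -/
theorem Adm.abs_fT_le_two (u : ℝ) (_hu : 1 < u) : |fT R S δ M u| ≤ 2 := by
  by_cases hc : cutoff R S M < u
  · have hu1 : 1 < u := lt_trans one_lt_cutoff hc
    rw [fT_of_lt hc, abs_of_nonneg (h.f_nonneg u)]
    have hW := wBound_pos (R := R) (S := S) (M := M)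
    have hlog : wBound R S M / 2 < Real.log u := by
      have := Real.log_lt_log (lt_trans one_pos one_lt_cutoff) hc
      rwa [cutoff, Real.log_exp] at this
    have hL : 0 < Real.log u := Real.log_pos hu1
    calc f R S δ M u ≤ wBound R S M / Real.log u := h.f_le_div_log hu1
      _ ≤ 2 := by rw [div_le_iff₀ hL]; linarith
  · rw [fT_of_le (not_lt.mp hc)]; norm_num

omit h in
/-- The constant `K = W + W √u₀` of the density comparison for `fT`. [cite: BrouckeDebruyneRevesz2023, proof of Theorem 3.2] -/
def cmpK (R S : Finset ℝ) (M : ℕ) : ℝ := wBound R S M + wBound R S M * Real.sqrt (cutoff R S M)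

/-- **`0 ≤ g − fT ≤ K u^{−1/2}` on `(1, ∞)`**: beyond `u₀` this is `g − f ≤ W u^{−1/2}`; up to `u₀`,
`g ≤ W ≤ W√u₀ · u^{−1/2}`. [cite: BrouckeDebruyneRevesz2023, proof of Theorem 3.2] -/
theorem Adm.g_sub_fT_mem (u : ℝ) (hu : 1 < u) :
    0 ≤ g R S δ M u - fT R S δ M u ∧ g R S δ M u - fT R S δ M u ≤ cmpK R S M * u ^ (-(1 / 2 : ℝ)) := by
  have hu0 : 0 < u := lt_trans one_pos hu
  have hW := wBound_pos (R := R) (S := S) (M := M)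
  have hr : 0 < u ^ (-(1 / 2 : ℝ)) := Real.rpow_pos_of_pos hu0 _
  refine ⟨by linarith [(h.fT_mem u).2, h.f_le_g u], ?_⟩
  by_cases hc : cutoff R S M < u
  · rw [fT_of_lt hc]
    calc g R S δ M u - f R S δ M u ≤ wBound R S M * u ^ (-(1 / 2 : ℝ)) := h.g_sub_f_le hu
      _ ≤ cmpK R S M * u ^ (-(1 / 2 : ℝ)) := by
          refine mul_le_mul_of_nonneg_right ?_ hr.le
          unfold cmpK; have := Real.sqrt_nonneg (cutoff R S M); nlinarith
  · have huc : u ≤ cutoff R S M := not_lt.mp hc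
    rw [fT_of_le huc, sub_zero]
    -- `1 ≤ √u₀ · u^{−1/2}` since `u ≤ u₀`
    have h1 : 1 ≤ Real.sqrt (cutoff R S M) * u ^ (-(1 / 2 : ℝ)) := by
      have hsu : Real.sqrt u ≤ Real.sqrt (cutoff R S M) := Real.sqrt_le_sqrt huc
      have hsu0 : 0 < Real.sqrt u := Real.sqrt_pos.mpr hu0
      have hinv : u ^ (-(1 / 2 : ℝ)) = (Real.sqrt u)⁻¹ := by
        rw [Real.rpow_neg hu0.le, Real.sqrt_eq_rpow]
      rw [hinv, ← div_eq_mul_inv, le_div_iff₀ hsu0, one_mul]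
      exact hsu
    calc g R S δ M u ≤ wBound R S M := h.g_le_wBound u
      _ ≤ wBound R S M * (Real.sqrt (cutoff R S M) * u ^ (-(1 / 2 : ℝ))) := le_mul_of_one_le_right hW.le h1
      _ ≤ cmpK R S M * u ^ (-(1 / 2 : ℝ)) := by
          unfold cmpK
          nlinarith [mul_pos hW hr]

/-! ### Transfer of the approximation hypothesis (1.3) from `f` to `fT` -/

/-- The template exponential integrals of `f` and `fT` differ by at most `W(u₀ − 1)`:
`‖S_f(x,t) − S_{fT}(x,t)‖ ≤ ∫₁^{min(x,u₀)} f ≤ W(u₀ − 1)`. [cite: BrouckeDebruyneRevesz2023, proof of Theorem 3.2] -/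
theorem Adm.norm_tmplSum_sub_le {x : ℝ} (hx : 1 ≤ x) (t : ℝ) :
    ‖BV.tmplSum (f R S δ M) x t - BV.tmplSum (fT R S δ M) x t‖ ≤ wBound R S M * (cutoff R S M - 1) := by
  have hW := wBound_pos (R := R) (S := S) (M := M)
  have hc1 := one_lt_cutoff (R := R) (S := S) (M := M)
  -- the difference integrand `(f − fT)(u) u^{−it}` and its bound
  set d : ℝ → ℂ := fun u ↦ BV.tmplIntegrand (f R S δ M) t u - BV.tmplIntegrand (fT R S δ M) t u with hd
  have hd_eq : ∀ u, d u = ((f R S δ M u - fT R S δ M u : ℝ) : ℂ) * (u : ℂ) ^ (-(t * I)) := by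
    intro u; simp only [hd, BV.tmplIntegrand]; push_cast; ring
  have hd_norm : ∀ u, 0 < u → ‖d u‖ = f R S δ M u - fT R S δ M u := by
    intro u hu
    rw [hd_eq, norm_mul, norm_cpow_neg_mul_I hu, mul_one, Complex.norm_real, Real.norm_eq_abs,
      abs_of_nonneg (by linarith [(h.fT_mem u).2])]
  have hd_le : ∀ u, 0 < u → ‖d u‖ ≤ wBound R S M := fun u hu ↦ by
    rw [hd_norm u hu]; linarith [(h.fT_mem u).1, h.f_le_wBound u]
  have hd_zero : ∀ u, cutoff R S M < u → d u = 0 := fun u hu ↦ by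
    rw [hd_eq, fT_of_lt hu, sub_self]; simp
  -- integrability of `d` on `[1, b]` (bounded and measurable)
  have hdm : Measurable d :=
    (BV.measurable_tmplIntegrand h.measurable_f t).sub (BV.measurable_tmplIntegrand h.measurable_fT t)
  have hint : ∀ b : ℝ, 1 ≤ b → IntervalIntegrable d volume 1 b := by
    intro b hb
    rw [intervalIntegrable_iff_integrableOn_Ioc_of_le hb]
    refine Measure.integrableOn_of_bounded (M := wBound R S M) measure_Ioc_lt_top.ne hdm.aestronglyMeasurable ?_
    rw [ae_restrict_iff' measurableSet_Ioc]
    exact Eventually.of_forall fun u hu ↦ hd_le u (lt_trans one_pos hu.1)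
  have hintf : ∀ b : ℝ, 1 ≤ b → IntervalIntegrable (BV.tmplIntegrand (f R S δ M) t) volume 1 b := by
    intro b hb
    rw [intervalIntegrable_iff_integrableOn_Ioc_of_le hb]
    refine Measure.integrableOn_of_bounded (M := wBound R S M) measure_Ioc_lt_top.ne
      (BV.measurable_tmplIntegrand h.measurable_f t).aestronglyMeasurable ?_
    rw [ae_restrict_iff' measurableSet_Ioc]
    refine Eventually.of_forall fun u hu ↦ ?_
    rw [BV.tmplIntegrand, norm_mul, norm_cpow_neg_mul_I (lt_trans one_pos hu.1), mul_one, Complex.norm_real,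
      Real.norm_eq_abs]
    exact h.abs_f_le u
  have hintT : ∀ b : ℝ, 1 ≤ b → IntervalIntegrable (BV.tmplIntegrand (fT R S δ M) t) volume 1 b := by
    intro b hb
    have := (hintf b hb).sub (hint b hb)
    refine this.congr fun u _ ↦ ?_
    simp only [hd, sub_sub_cancel]
  -- the difference of the template sums is `∫₁ˣ d`
  have hsub : BV.tmplSum (f R S δ M) x t - BV.tmplSum (fT R S δ M) x t = ∫ u in (1 : ℝ)..x, d u := by
    rw [BV.tmplSum, BV.tmplSum, ← intervalIntegral.integral_sub (hintf x hx) (hintT x hx)]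
  -- the bound on `[1, b]` for `b ≤ u₀`
  have hpiece : ∀ b : ℝ, 1 ≤ b → b ≤ cutoff R S M → ‖∫ u in (1 : ℝ)..b, d u‖ ≤ wBound R S M * (cutoff R S M - 1) := by
    intro b hb hbc
    have h1 : ‖∫ u in (1 : ℝ)..b, d u‖ ≤ wBound R S M * |b - 1| :=
      intervalIntegral.norm_integral_le_of_norm_le_const fun u hu ↦ by
        rw [uIoc_of_le hb] at hu
        exact hd_le u (lt_trans one_pos hu.1)
    rw [abs_of_nonneg (by linarith)] at h1
    exact h1.trans (mul_le_mul_of_nonneg_left (by linarith) hW.le)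
  rw [hsub]
  rcases le_or_gt x (cutoff R S M) with hxc | hxc
  · exact hpiece x hx hxc
  · -- split at `u₀`; the second piece vanishes
    have hsplit : ∫ u in (1 : ℝ)..x, d u = (∫ u in (1 : ℝ)..cutoff R S M, d u) + ∫ u in cutoff R S M..x, d u :=
      (intervalIntegral.integral_add_adjacent_intervals (hint _ hc1.le)
        ((hint x hx).mono_set (by
          rw [uIcc_of_le hxc.le, uIcc_of_le hx]
          exact Icc_subset_Icc hc1.le le_rfl))).symm
    have hzero : ∫ u in cutoff R S M..x, d u = 0 := by
      rw [intervalIntegral.integral_of_le hxc.le]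
      refine (setIntegral_congr_fun measurableSet_Ioc (g := fun _ ↦ (0 : ℂ)) fun u hu ↦ hd_zero u hu.1).trans ?_
      simp
    rw [hsplit, hzero, add_zero]
    exact hpiece _ hc1.le le_rfl

/-- **Transfer of (1.3)**: `BV.Approx f P A → BV.Approx fT P (A + W(u₀ − 1))` (the gauge is `≥ √x ≥ 1`).
[cite: BrouckeDebruyneRevesz2023, proof of Theorem 3.2] -/
theorem Adm.approx_fT {P : BeurlingPrimes} {A : ℝ} (hA : BV.Approx (f R S δ M) P A) :
    BV.Approx (fT R S δ M) P (A + wBound R S M * (cutoff R S M - 1)) := by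
  intro x hx t
  have h1 := hA x hx t
  have h2 := h.norm_tmplSum_sub_le hx t
  have hg : 1 ≤ BV.gauge x t := (Real.one_le_sqrt.mpr hx).trans (BV.sqrt_le_gauge x t)
  have hW := wBound_pos (R := R) (S := S) (M := M)
  have hc := one_lt_cutoff (R := R) (S := S) (M := M)
  have hK : 0 ≤ wBound R S M * (cutoff R S M - 1) := mul_nonneg hW.le (by linarith)
  calc ‖P.primeSum x t - BV.tmplSum (fT R S δ M) x t‖
      = ‖(P.primeSum x t - BV.tmplSum (f R S δ M) x t) +
          (BV.tmplSum (f R S δ M) x t - BV.tmplSum (fT R S δ M) x t)‖ := by rw [sub_add_sub_cancel]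
    _ ≤ A * BV.gauge x t + wBound R S M * (cutoff R S M - 1) := (norm_add_le _ _).trans (add_le_add h1 h2)
    _ ≤ A * BV.gauge x t + wBound R S M * (cutoff R S M - 1) * BV.gauge x t := by
        refine add_le_add le_rfl (le_mul_of_one_le_right hK hg)
    _ = (A + wBound R S M * (cutoff R S M - 1)) * BV.gauge x t := by ring

end BDR

end Literature.NumberTheory.BeurlingPrimes
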